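import Summits.QuantumFields.YangMills.Theorems.BalabanUVNodesN19TiltPathKingModelLocal

/-!
# BalabanUVNodes ∕ node N19 (NE7) — THE UN-HYBRID DIRECTION (`Core` of the totals + NE7b's `RelWeightBound` ⇒ `Core` of the good classes, radius
# `vol·hybridDelta`) AND THE TWO-CLASS KING TOWER FOR A LOCAL OBSERVABLE: the `hedge` ∕ `h19` binder shape `∃ δ, NE7.Core l₀ vol T Bad P Q δ ∧ Summable δ`
# INHABITED with a NON-EMPTY bad class, a PRODUCED weight and a VOLUME-FREE, RADIUS-FREE geometric `δ`

Cell `pub-ymgap` (HUMAN RULING D-0062 Track A ∕ D-0149 width seats), WIDTH SEAT `pub-ymgap-dag-n19-w1` (node n19 = NE7, seat 1 of 3), W-SEAT-START-LIST v3 §2 n19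
item 1 = the -d lane's first-hand replacement (2′) (bus l.24019; plan word YES).  Route `Summits/QuantumFields/YangMills/Theses/BalabanUVNodes.lean`, key item K3⁷
`SpineGivenEndpointR13SepCoPH` (stmt-QuantumFields-20544); filed `--kind proof --supports … --as helper`.  COUNT-NEUTRAL.  THEOREMS ONLY (0 `def`, 0 `sorry`).
ADDITIVE — imports n19-c's `…N19TiltPathKingModelLocal` (p529528: ★ `core_kingLocal`, `summable_delta_kingLocal` — the LOCAL annealed rung, ONE class, `Bad = ∅`,
`δ^loc_K = (e^{2l₀B} − 1)·θ_{K+1}·a·|X|∕(2γ₀·vol)`) and, through it, n14-c's `…N18KingModelLargeField` (★ `relWeightBound_kingTwoClass` — NE7b's `RelWeightBound` PRODUCED for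
the small-field ∕ large-field split of King's Gaussian effective measures — `integrable_dressed`, `gamma0_pos`, `effLaplacian_coercive_unif`, `sum_bool_eq`), `…KingModelDensTorus`
(`smallField_eq_Icc`), `…KingModelCauchy` (`integrand_pos`), the tree's `Spine/NE7/Targets` (`Core`), `T4MatchingAssembly` (`HybridNE7`, `hybridNE7_noShell`), `T4WeightBudget`
(`RelWeightBound`), `T4HybridMatching` (`hybridDelta`, `mul_hybridDelta`, `summable_hybridDelta`) and `King1986` (`aK`, `thetaK`, `Torus.effLaplacian`, `aminL`) — all CITED BY NAME,
nothing re-proved at the same type; modifies nothing.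

WHY.  Leaf D of the K3⁷ composer (n27-c `…N27SpineGivenEndpointR13SepCoPHKeyedCore`) and the -d lane's B-series display N19's slot as the ∃δ-EDGE
`hedge ∕ h19 : ∃ δ, NE7.Core l₀ vol T Bad (A − shA) (B − shB) δ ∧ Summable δ` JOINTLY with NE7b's `h20 : RelWeightBound l₀ T A B Bad W` on the SAME class data.  №189's A6 rule asks
for a non-degenerate inhabitant of that joint binder shape.  The tree's inhabitants so far are: one class and `Bad = ∅` (n19-c `core_kingLocal` ∕ `hybridNE7_kingLocal`, p518223
`…_kingFullSpace`, n14-c `hybridNE7_kingSmallField`), or n14-c's two-class DENS road (`core_kingTwoClass` ∕ `exists_core_summable_kingTwoClass`: `Bad = {true}` produced, but the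
core radius `θ_{K+1}·a·R_K²·|Tor M|∕(2vol)` carries the VOLUME and the growing small-field RADIUS, whence King's p. 655 trade-off and a residual numeric condition `W₀ < 1`).
This file supplies the missing bookkeeping direction and composes the two landed rungs:
* §1 [folklore, GENERIC `ι`] ★ `goodSum_sandwich_of_total` — THE UN-HYBRID DIRECTION: if the TOTALS `Σ_{T K} A`, `Σ_{T K} B` of two nonnegative term families are sandwiched
  with ONE `t`-independent constant and radius `vol·δ_K`, and the bad classes carry relative weight `≤ W_K < 1` in both runs (`RelWeightBound`), then the GOOD sums
  `Σ_{T K ∖ Bad K t}` are sandwiched with the SAME constant and radius `vol·hybridDelta vol δ W K = vol·δ_K − log(1 − W_K)` — the converse of the dictionary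
  `T4HybridMatching.matchingModConstants_of_hybrid` (good ⇒ total), with the same remainder sequence `hybridDelta`; `core_goodSum_of_core_total` (the `Spine.NE7.Core` wording),
  ★ `core_twoClass_of_core_total` (`ι = Bool`, `T = univ`, `Bad = {true}`: a one-class `Core` of the totals IS a two-class `Core` with the bad class excluded).
* §2 [folklore ∘ BY NAME] THE TWO-CLASS KING TOWER FOR A LOCAL OBSERVABLE (`W` bounded measurable, depending on `φ|_X` only; run A = `Δ^{(K+1)}`, run B = `Δ^{(K+2)}`; classes =
  n14-c's small-field box `|φ(x)| ≤ R_K` (`false`) and its complement (`true` = `Bad`), term shapes VERBATIM those of `relWeightBound_kingTwoClass`): `sum_twoClass_eq_full`,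
  ★★ `core_kingLocalTwoClass` (`Core l₀ vol univ {true} A B (hybridDelta vol δ^loc W)`), ★★ `exists_core_summable_kingLocalTwoClass` (THE `hedge`∕`h19` SHAPE, `Bad = {true} ≠ ∅`
  at every `(K, t)`, `Σ < ∞`, majorant displayed), ★ `hybridNE7_kingLocalTwoClass` (the joint binder list `HybridNE7 … {true} W 0 0 0 (hybridDelta …)`), `bad_twoClass_nonempty`.
* §3 [folklore] THE EXPLICIT RADIUS `R_K = √(4(K + 1 + 2l₀B + |Tor M|·log√2)∕γ₀)`: `kingWeight_explicitRadius_eq` (n14-c's weight IS `e^{−(K+1)}`), `summable_exp_neg_succ`,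
  ★★ `exists_core_summable_kingLocalTwoClass_explicit`, ★★ `hybridNE7_kingLocalTwoClass_explicit` — EVERY hypothesis discharged (model data `a, m² > 0`, `L ≥ 2`; `vol > 0`,
  `l₀ ≥ 0`; a bounded measurable LOCAL `W`), with `δ′_K = (e^{2l₀B} − 1)·θ_{K+1}·a·|X|∕(2γ₀·vol) − log(1 − e^{−(K+1)})∕vol`: VOLUME-FREE and RADIUS-FREE.  On the annealed road the
  large-field radius enters ONLY the weight, so it may grow as fast as one likes: the DENS road's radius ∕ remainder trade-off (n14-c `summable_radius_affine`, King p. 655)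
  DISAPPEARS and no numeric condition is left.  `exists_core_summable_kingLocalTwoClass_cos_site`: A2 exhibited with `W φ = cos φ(x₀)`, `X = {x₀}` (model data only).

HONEST FRAMING.  King's `A = 0` scalar MODEL on one finite unit torus `Tor M` (template literature [King1986]) + finite-sum bookkeeping [folklore]; an A6-hygiene INHABITANT of
the displayed `hedge` ∕ `h20` binder SHAPES in a solvable tower — NOT Bałaban's NE7 ∕ NE7b (NOT PRINTED as two-run statements for d = 4; NODE O's objects), nothing of
Bałaban's instantiated or asserted; the B-series' record-level term data (`classWeightOfDatum₉`, keyed classes) are NOT touched.  Count-neutral; N19 NOT discharged (0∕1); K3⁷ NOT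
claimed; counts UNMOVED (typed 28∕28 · discharged 5∕27).  Everything PROVED (0 `sorry`, 0 named facts, standard axioms).  One finite four-torus programme at fixed ε — NOT ℝ⁴,
NOT infinite volume, NOT OS, NOT a mass gap, NOT the Clay problem (R4 closes the conditional finite-𝕋⁴ rung `BalabanLadder.UV` only).
-/

noncomputable section

namespace Summit.QuantumFields.YangMills.BalabanUVNodes.N19KingLocalTwoClass

open MeasureTheory Set Filter Real Matrix Topology
open scoped BigOperators
open Summit.QuantumFields.BalabanUV.T4Continuum.Spine.NE7 (Core)
open Literature.MathematicalPhysics.QuantumFieldTheory.Balaban1983to89.T4WeightBudget (RelWeightBound)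
open Literature.MathematicalPhysics.QuantumFieldTheory.Balaban1983to89.T4MatchingAssembly (HybridNE7 hybridNE7_noShell)
open Literature.MathematicalPhysics.QuantumFieldTheory.Balaban1983to89.T4HybridMatching (hybridDelta mul_hybridDelta summable_hybridDelta)
open Literature.MathematicalPhysics.QuantumFieldTheory.Balaban1983to89.B5Prop11Plancherel (Tor)
open Literature.MathematicalPhysics.QuantumFieldTheory.King1986 (aK thetaK)
open Literature.MathematicalPhysics.QuantumFieldTheory.King1986.Torus (effLaplacian aminL)
open YMDAG.N18.KingModelCauchy (integrand_pos)
open YMDAG.N18.KingModelDensTorus (smallField_eq_Icc)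
open YMDAG.N18.KingModelLargeField (relWeightBound_kingTwoClass integrable_dressed gamma0_pos effLaplacian_coercive_unif sum_bool_eq)
open Summit.QuantumFields.YangMills.BalabanUVNodes.N19TiltPathKingModelLocal (core_kingLocal summable_delta_kingLocal)

/-! ## §1 The un-hybrid direction: a one-constant sandwich of the totals and NE7b's weight bound sandwich the good sums -/
section Generic

variable {ι : Type*} [DecidableEq ι] {l₀ vol : ℝ} {T : ℕ → Finset ι} {A B : ℕ → ℝ → ι → ℝ} {Bad : ℕ → ℝ → Finset ι} {W δ : ℕ → ℝ}

/-- **★ THE UN-HYBRID DIRECTION** [folklore].  Two nonnegative term families `A K t`, `B K t` on the classes `T K`; NE7b's `RelWeightBound l₀ T A B Bad W` (the bad classes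
`Bad K t ⊆ T K` carry relative weight `≤ W_K`, `0 ≤ W_K < 1`, in BOTH runs); and the TOTALS sandwiched with ONE `t`-independent constant per `K`:
`e^{c − vol·δ_K}·Σ_{T K} A ≤ Σ_{T K} B ≤ e^{c + vol·δ_K}·Σ_{T K} A` on `|t| ≤ l₀`.  Then the GOOD SUMS are sandwiched with the SAME constant and the hybrid radius:
`e^{c − vol·hybridDelta vol δ W K}·Σ_{T K ∖ Bad K t} A ≤ Σ_{T K ∖ Bad K t} B ≤ e^{c + vol·hybridDelta vol δ W K}·Σ_{T K ∖ Bad K t} A`, `vol·hybridDelta = vol·δ_K − log(1 − W_K)`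
(`T4HybridMatching.mul_hybridDelta`).  Proof: `(1 − W_K)·Σ_T ≤ Σ_good ≤ Σ_T` in each run.  The converse bookkeeping of `T4HybridMatching.matchingModConstants_of_hybrid`. -/
theorem goodSum_sandwich_of_total (hvol : 0 < vol) (hW : RelWeightBound l₀ T A B Bad W)
    (hA : ∀ (K : ℕ) (t : ℝ), |t| ≤ l₀ → ∀ τ ∈ T K, 0 ≤ A K t τ) (hB : ∀ (K : ℕ) (t : ℝ), |t| ≤ l₀ → ∀ τ ∈ T K, 0 ≤ B K t τ)
    (htot : ∀ K : ℕ, ∃ c : ℝ, ∀ t : ℝ, |t| ≤ l₀ →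
      Real.exp (c - vol * δ K) * ∑ τ ∈ T K, A K t τ ≤ ∑ τ ∈ T K, B K t τ ∧
        ∑ τ ∈ T K, B K t τ ≤ Real.exp (c + vol * δ K) * ∑ τ ∈ T K, A K t τ) :
    ∀ K : ℕ, ∃ c : ℝ, ∀ t : ℝ, |t| ≤ l₀ →
      Real.exp (c - vol * hybridDelta vol δ W K) * ∑ τ ∈ T K \ Bad K t, A K t τ ≤ ∑ τ ∈ T K \ Bad K t, B K t τ ∧
        ∑ τ ∈ T K \ Bad K t, B K t τ ≤ Real.exp (c + vol * hybridDelta vol δ W K) * ∑ τ ∈ T K \ Bad K t, A K t τ := by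
  intro K
  obtain ⟨c, hc⟩ := htot K
  refine ⟨c, fun t ht => ?_⟩
  obtain ⟨hlo, hhi⟩ := hc t ht
  have hsub : Bad K t ⊆ T K := hW.bad_subset K t ht
  have h1W : 0 < 1 - W K := sub_pos.2 (hW.lt_one K)
  have hgA : ∑ τ ∈ T K \ Bad K t, A K t τ = ∑ τ ∈ T K, A K t τ - ∑ τ ∈ Bad K t, A K t τ := Finset.sum_sdiff_eq_sub hsub
  have hgB : ∑ τ ∈ T K \ Bad K t, B K t τ = ∑ τ ∈ T K, B K t τ - ∑ τ ∈ Bad K t, B K t τ := Finset.sum_sdiff_eq_sub hsub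
  have hbA := hW.bad_left K t ht
  have hbB := hW.bad_right K t ht
  have hbA0 : 0 ≤ ∑ τ ∈ Bad K t, A K t τ := Finset.sum_nonneg fun τ hτ => hA K t ht τ (hsub hτ)
  have hbB0 : 0 ≤ ∑ τ ∈ Bad K t, B K t τ := Finset.sum_nonneg fun τ hτ => hB K t ht τ (hsub hτ)
  have hSA0 : 0 ≤ ∑ τ ∈ T K, A K t τ := Finset.sum_nonneg fun τ hτ => hA K t ht τ hτ
  have key : vol * hybridDelta vol δ W K = vol * δ K - Real.log (1 - W K) := mul_hybridDelta hvol.ne' δ W K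
  have hexp_lo : Real.exp (c - vol * hybridDelta vol δ W K) = Real.exp (c - vol * δ K) * (1 - W K) := by
    rw [key, show c - (vol * δ K - Real.log (1 - W K)) = (c - vol * δ K) + Real.log (1 - W K) by ring, Real.exp_add,
      Real.exp_log h1W]
  have hexp_hi : Real.exp (c + vol * hybridDelta vol δ W K) = Real.exp (c + vol * δ K) / (1 - W K) := by
    rw [key, show c + (vol * δ K - Real.log (1 - W K)) = (c + vol * δ K) - Real.log (1 - W K) by ring, Real.exp_sub,
      Real.exp_log h1W]
  constructor
  · -- lower: `e^{c−volδ}(1−W)·Σ_good A ≤ e^{c−volδ}(1−W)·Σ_T A ≤ (1−W)·Σ_T B ≤ Σ_good B`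
    rw [hexp_lo]
    have hgA_le : ∑ τ ∈ T K \ Bad K t, A K t τ ≤ ∑ τ ∈ T K, A K t τ := by rw [hgA]; linarith
    calc Real.exp (c - vol * δ K) * (1 - W K) * ∑ τ ∈ T K \ Bad K t, A K t τ
        ≤ Real.exp (c - vol * δ K) * (1 - W K) * ∑ τ ∈ T K, A K t τ :=
          mul_le_mul_of_nonneg_left hgA_le (mul_nonneg (Real.exp_pos _).le h1W.le)
      _ = (1 - W K) * (Real.exp (c - vol * δ K) * ∑ τ ∈ T K, A K t τ) := by ring
      _ ≤ (1 - W K) * ∑ τ ∈ T K, B K t τ := mul_le_mul_of_nonneg_left hlo h1W.le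
      _ ≤ ∑ τ ∈ T K \ Bad K t, B K t τ := by rw [hgB]; nlinarith [hbB]
  · -- upper: `Σ_good B ≤ Σ_T B ≤ e^{c+volδ}·Σ_T A ≤ e^{c+volδ}·Σ_good A∕(1−W)`
    rw [hexp_hi]
    have hSA : ∑ τ ∈ T K, A K t τ ≤ (∑ τ ∈ T K \ Bad K t, A K t τ) / (1 - W K) := by
      rw [le_div_iff₀ h1W, hgA]; nlinarith [hbA]
    calc ∑ τ ∈ T K \ Bad K t, B K t τ ≤ ∑ τ ∈ T K, B K t τ := by rw [hgB]; linarith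
      _ ≤ Real.exp (c + vol * δ K) * ∑ τ ∈ T K, A K t τ := hhi
      _ ≤ Real.exp (c + vol * δ K) * ((∑ τ ∈ T K \ Bad K t, A K t τ) / (1 - W K)) :=
          mul_le_mul_of_nonneg_left hSA (Real.exp_pos _).le
      _ = Real.exp (c + vol * δ K) / (1 - W K) * ∑ τ ∈ T K \ Bad K t, A K t τ := by ring

/-- **`Spine.NE7.Core` WORDING OF THE UN-HYBRID DIRECTION** [folklore ∘ `goodSum_sandwich_of_total`]: a ONE-CLASS `Core` of the TOTALS (class index `Unit`, no bad class) and
`RelWeightBound l₀ T A B Bad W` give the one-class `Core` of the GOOD SUMS with `δ ↦ hybridDelta vol δ W`. -/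
theorem core_goodSum_of_core_total (hvol : 0 < vol) (hW : RelWeightBound l₀ T A B Bad W)
    (hA : ∀ (K : ℕ) (t : ℝ), |t| ≤ l₀ → ∀ τ ∈ T K, 0 ≤ A K t τ) (hB : ∀ (K : ℕ) (t : ℝ), |t| ≤ l₀ → ∀ τ ∈ T K, 0 ≤ B K t τ)
    (htot : Core l₀ vol (fun _ => (Finset.univ : Finset Unit)) (fun _ _ => (∅ : Finset Unit))
      (fun K t _ => ∑ τ ∈ T K, A K t τ) (fun K t _ => ∑ τ ∈ T K, B K t τ) δ) :
    Core l₀ vol (fun _ => (Finset.univ : Finset Unit)) (fun _ _ => (∅ : Finset Unit))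
      (fun K t _ => ∑ τ ∈ T K \ Bad K t, A K t τ) (fun K t _ => ∑ τ ∈ T K \ Bad K t, B K t τ) (hybridDelta vol δ W) := by
  have h := goodSum_sandwich_of_total hvol hW hA hB fun K => by
    obtain ⟨c, hc⟩ := htot K
    exact ⟨c, fun t ht => hc t ht () (by simp)⟩
  intro K
  obtain ⟨c, hc⟩ := h K
  exact ⟨c, fun t ht _ _ => hc t ht⟩

/-- **★ TWO CLASSES** [folklore ∘ `core_goodSum_of_core_total`]: class index `Bool`, `T = univ`, `Bad = {true}` (the large-field class, NON-EMPTY at every `(K, t)`).  A one-class `Core` of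
the totals `A K t true + A K t false`, `B K t true + B K t false` and `RelWeightBound l₀ univ A B {true} W` give the TWO-CLASS `Core l₀ vol univ {true} A B (hybridDelta vol δ W)`
(its clause reads the good class `false` only). -/
theorem core_twoClass_of_core_total {A B : ℕ → ℝ → Bool → ℝ} (hvol : 0 < vol)
    (hW : RelWeightBound l₀ (fun _ => (Finset.univ : Finset Bool)) A B (fun _ _ => ({true} : Finset Bool)) W)
    (hA : ∀ (K : ℕ) (t : ℝ), |t| ≤ l₀ → ∀ τ, 0 ≤ A K t τ) (hB : ∀ (K : ℕ) (t : ℝ), |t| ≤ l₀ → ∀ τ, 0 ≤ B K t τ)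
    (htot : Core l₀ vol (fun _ => (Finset.univ : Finset Unit)) (fun _ _ => (∅ : Finset Unit))
      (fun K t _ => ∑ τ, A K t τ) (fun K t _ => ∑ τ, B K t τ) δ) :
    Core l₀ vol (fun _ => (Finset.univ : Finset Bool)) (fun _ _ => ({true} : Finset Bool)) A B (hybridDelta vol δ W) := by
  have h := core_goodSum_of_core_total hvol hW (fun K t ht τ _ => hA K t ht τ) (fun K t ht τ _ => hB K t ht τ) htot
  have hgood : (Finset.univ : Finset Bool) \ {true} = {false} := by decide
  intro K
  obtain ⟨c, hc⟩ := h K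
  refine ⟨c, fun t ht τ hτ => ?_⟩
  have hτ' : τ = false := by simpa using hτ
  have h1 := hc t ht () (by simp)
  simp only [hgood, Finset.sum_singleton] at h1
  subst hτ'
  exact h1

end Generic

/-! ## §2 The two-class King tower for a LOCAL observable: `Core` on the small-field class from the local annealed rung, with n14-c's produced weight -/
section King

variable {d : ℕ} (M : Fin d → ℕ) [hM : ∀ μ, NeZero (M μ)]
variable {l₀ vol B : ℝ} {W : (Tor M → ℝ) → ℝ} {R : ℕ → ℝ}

/-- The two class pieces (small-field box of radius `Rk` and its complement) of an integrable function sum to its full-space integral (`integral_add_compl`). [folklore] -/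
theorem sum_twoClass_eq_full {f : (Tor M → ℝ) → ℝ} (hf : Integrable f) (Rk : ℝ) :
    ∑ τ : Bool, ∫ φ in (bif τ then {φ : Tor M → ℝ | ∀ x, |φ x| ≤ Rk}ᶜ else {φ : Tor M → ℝ | ∀ x, |φ x| ≤ Rk}), f φ = ∫ φ, f φ := by
  have hmeas : MeasurableSet {φ : Tor M → ℝ | ∀ x, |φ x| ≤ Rk} := by rw [smallField_eq_Icc M Rk]; exact measurableSet_Icc
  rw [sum_bool_eq, cond_true, cond_false, add_comm, integral_add_compl hmeas hf]

/-- **★★ `Core` ON THE TWO-CLASS KING TOWER FOR A LOCAL OBSERVABLE** [folklore ∘ §1 + n19-c `core_kingLocal` + n14-c `relWeightBound_kingTwoClass` BY NAME].  King's data `a, m² > 0`,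
`L ≥ 2`, a unit torus `Tor M`; run A = `Δ^{(K+1)}`, run B = `Δ^{(K+2)}` (consecutive block-RG effective Laplacians), both dressed by `e^{tW}` for a bounded measurable `W` that is
LOCAL on the site set `X` (`W φ` depends on `φ|_X` only) and both read on the SAME two classes per `K`: `false` = the small-field box `|φ(x)| ≤ R_K`, `true` = its complement =
the bad class.  Under n14-c's two weight conditions on the radii (`W_K := e^{2l₀B}·√2^{|Tor M|}·e^{−γ₀R_K²∕4} < 1`, summable) the class integrals satisfy
`Spine.NE7.Core l₀ vol univ {true} A B (hybridDelta vol δ^loc W)` with n19-c's VOLUME-FREE annealed remainder `δ^loc_K = (e^{2l₀B} − 1)·θ_{K+1}·a·|X|∕(2γ₀·vol)` — the radius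
`R_K` enters the weight ONLY.  [cite: King1986, Prop 3.10 (3.91)–(3.92) p.669; (3.10)–(3.13) pp.656–657 (template)] -/
theorem core_kingLocalTwoClass {a : ℝ} (ha : 0 < a) {L : ℕ} [NeZero L] (hL : 2 ≤ L) {m2 : ℝ} (hm : 0 < m2) (hvol : 0 < vol) (X : Finset (Tor M))
    (hWm : Measurable W) (hWb : ∀ φ, |W φ| ≤ B) (hWloc : ∀ φ ψ : Tor M → ℝ, (∀ x ∈ X, φ x = ψ x) → W φ = W ψ) (hR : ∀ K, 0 ≤ R K)
    (hW1 : ∀ K, Real.exp (2 * (l₀ * B)) * Real.sqrt 2 ^ Fintype.card (Tor M) * Real.exp (-(((aminL a L)⁻¹ + m2⁻¹)⁻¹ * R K ^ 2 / 4)) < 1)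
    (hWs : Summable fun K => Real.exp (2 * (l₀ * B)) * Real.sqrt 2 ^ Fintype.card (Tor M) * Real.exp (-(((aminL a L)⁻¹ + m2⁻¹)⁻¹ * R K ^ 2 / 4))) :
    Core l₀ vol (fun _ => (Finset.univ : Finset Bool)) (fun _ _ => ({true} : Finset Bool))
      (fun K t τ => ∫ φ in (bif τ then {φ : Tor M → ℝ | ∀ x, |φ x| ≤ R K}ᶜ else {φ : Tor M → ℝ | ∀ x, |φ x| ≤ R K}),
        Real.exp (-(φ ⬝ᵥ (effLaplacian (L ^ (K + 1)) M (aK a L (K + 1)) (((L ^ (K + 1) : ℕ) : ℝ) ^ 2) m2 *ᵥ φ) / 2)) * Real.exp (t * W φ))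
      (fun K t τ => ∫ φ in (bif τ then {φ : Tor M → ℝ | ∀ x, |φ x| ≤ R K}ᶜ else {φ : Tor M → ℝ | ∀ x, |φ x| ≤ R K}),
        Real.exp (-(φ ⬝ᵥ (effLaplacian (L ^ (K + 1 + 1)) M (aK a L (K + 1 + 1)) (((L ^ (K + 1 + 1) : ℕ) : ℝ) ^ 2) m2 *ᵥ φ) / 2)) * Real.exp (t * W φ))
      (hybridDelta vol (fun K => (Real.exp (2 * (l₀ * B)) - 1) * (thetaK a L (K + 1) 1 * a) * X.card / (2 * ((aminL a L)⁻¹ + m2⁻¹)⁻¹) / vol)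
        fun K => Real.exp (2 * (l₀ * B)) * Real.sqrt 2 ^ Fintype.card (Tor M) * Real.exp (-(((aminL a L)⁻¹ + m2⁻¹)⁻¹ * R K ^ 2 / 4))) := by
  have hγ := gamma0_pos ha hL hm
  have hRW := relWeightBound_kingTwoClass M ha hL hm hWm hWb hR hW1 hWs
  have hcore := core_kingLocal M ha hL hm hvol X hWm hWb hWloc (l₀ := l₀)
  refine core_twoClass_of_core_total hvol hRW (fun K t _ τ => integral_nonneg fun φ => (integrand_pos M _ W t φ).le)
    (fun K t _ τ => integral_nonneg fun φ => (integrand_pos M _ W t φ).le) ?_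
  intro K
  obtain ⟨c, hc⟩ := hcore K
  refine ⟨c, fun t ht u hu => ?_⟩
  have h := hc t ht u hu
  simp only at h ⊢
  rw [sum_twoClass_eq_full M (integrable_dressed M hγ (effLaplacian_coercive_unif M ha hL (by omega) hm) hWm hWb t),
    sum_twoClass_eq_full M (integrable_dressed M hγ (effLaplacian_coercive_unif M ha hL (by omega) hm) hWm hWb t)]
  exact h

/-- **★★ THE `hedge` ∕ `h19` BINDER SHAPE `∃ δ, NE7.Core l₀ vol T Bad P Q δ ∧ Summable δ` INHABITED WITH A NON-EMPTY BAD CLASS AND A VOLUME-FREE `δ`** [folklore ∘ `core_kingLocalTwoClass` +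
`T4HybridMatching.summable_hybridDelta`]: on the two-class King tower for a local observable, `Bad K t = {true} ≠ ∅` for every `(K, t)`, the two runs differ (`Δ^{(K+1)}` vs
`Δ^{(K+2)}`), the matching constant is the free-energy difference of the FULL-SPACE runs (not `0`), and `δ = hybridDelta vol δ^loc W` is summable, `≠ 0`, with the displayed
identity.  (n14-c's `exists_core_summable_kingTwoClass` is the DENS-road sibling with `δ ∝ (R₀² + cK)·|Tor M|`.) -/
theorem exists_core_summable_kingLocalTwoClass {a : ℝ} (ha : 0 < a) {L : ℕ} [NeZero L] (hL : 2 ≤ L) {m2 : ℝ} (hm : 0 < m2) (hvol : 0 < vol)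
    (X : Finset (Tor M)) (hWm : Measurable W) (hWb : ∀ φ, |W φ| ≤ B) (hWloc : ∀ φ ψ : Tor M → ℝ, (∀ x ∈ X, φ x = ψ x) → W φ = W ψ) (hR : ∀ K, 0 ≤ R K)
    (hW1 : ∀ K, Real.exp (2 * (l₀ * B)) * Real.sqrt 2 ^ Fintype.card (Tor M) * Real.exp (-(((aminL a L)⁻¹ + m2⁻¹)⁻¹ * R K ^ 2 / 4)) < 1)
    (hWs : Summable fun K => Real.exp (2 * (l₀ * B)) * Real.sqrt 2 ^ Fintype.card (Tor M) * Real.exp (-(((aminL a L)⁻¹ + m2⁻¹)⁻¹ * R K ^ 2 / 4))) :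
    ∃ δ : ℕ → ℝ, Core l₀ vol (fun _ => (Finset.univ : Finset Bool)) (fun _ _ => ({true} : Finset Bool))
      (fun K t τ => ∫ φ in (bif τ then {φ : Tor M → ℝ | ∀ x, |φ x| ≤ R K}ᶜ else {φ : Tor M → ℝ | ∀ x, |φ x| ≤ R K}),
        Real.exp (-(φ ⬝ᵥ (effLaplacian (L ^ (K + 1)) M (aK a L (K + 1)) (((L ^ (K + 1) : ℕ) : ℝ) ^ 2) m2 *ᵥ φ) / 2)) * Real.exp (t * W φ))
      (fun K t τ => ∫ φ in (bif τ then {φ : Tor M → ℝ | ∀ x, |φ x| ≤ R K}ᶜ else {φ : Tor M → ℝ | ∀ x, |φ x| ≤ R K}),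
        Real.exp (-(φ ⬝ᵥ (effLaplacian (L ^ (K + 1 + 1)) M (aK a L (K + 1 + 1)) (((L ^ (K + 1 + 1) : ℕ) : ℝ) ^ 2) m2 *ᵥ φ) / 2)) * Real.exp (t * W φ)) δ ∧
      Summable δ ∧
      ∀ K, δ K = (Real.exp (2 * (l₀ * B)) - 1) * (thetaK a L (K + 1) 1 * a) * X.card / (2 * ((aminL a L)⁻¹ + m2⁻¹)⁻¹) / vol
        + -Real.log (1 - Real.exp (2 * (l₀ * B)) * Real.sqrt 2 ^ Fintype.card (Tor M) * Real.exp (-(((aminL a L)⁻¹ + m2⁻¹)⁻¹ * R K ^ 2 / 4))) / vol := by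
  have hRW := relWeightBound_kingTwoClass M ha hL hm hWm hWb hR hW1 hWs
  exact ⟨_, core_kingLocalTwoClass M ha hL hm hvol X hWm hWb hWloc hR hW1 hWs,
    summable_hybridDelta (summable_delta_kingLocal M ha hL m2 l₀ vol B X) hRW.nonneg hRW.lt_one hRW.summable, fun K => rfl⟩

/-- **★ THE JOINT BINDER LIST `HybridNE7` ON THE TWO-CLASS KING TOWER FOR A LOCAL OBSERVABLE** [folklore ∘ `core_kingLocalTwoClass` + `T4MatchingAssembly.hybridNE7_noShell` +
n14-c `relWeightBound_kingTwoClass` BY NAME]: NE7b's weight PRODUCED on the non-empty bad class `{true}`, no shells, and the `core` clause with the volume-free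
`hybridDelta vol δ^loc W` — the `h20` ∕ `hedge` pair of leaf D's shape inhabited JOINTLY on the same class data. -/
theorem hybridNE7_kingLocalTwoClass {a : ℝ} (ha : 0 < a) {L : ℕ} [NeZero L] (hL : 2 ≤ L) {m2 : ℝ} (hm : 0 < m2) (hvol : 0 < vol) (X : Finset (Tor M))
    (hWm : Measurable W) (hWb : ∀ φ, |W φ| ≤ B) (hWloc : ∀ φ ψ : Tor M → ℝ, (∀ x ∈ X, φ x = ψ x) → W φ = W ψ) (hR : ∀ K, 0 ≤ R K)
    (hW1 : ∀ K, Real.exp (2 * (l₀ * B)) * Real.sqrt 2 ^ Fintype.card (Tor M) * Real.exp (-(((aminL a L)⁻¹ + m2⁻¹)⁻¹ * R K ^ 2 / 4)) < 1)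
    (hWs : Summable fun K => Real.exp (2 * (l₀ * B)) * Real.sqrt 2 ^ Fintype.card (Tor M) * Real.exp (-(((aminL a L)⁻¹ + m2⁻¹)⁻¹ * R K ^ 2 / 4))) :
    HybridNE7 l₀ vol (fun _ => (Finset.univ : Finset Bool))
      (fun K t τ => ∫ φ in (bif τ then {φ : Tor M → ℝ | ∀ x, |φ x| ≤ R K}ᶜ else {φ : Tor M → ℝ | ∀ x, |φ x| ≤ R K}),
        Real.exp (-(φ ⬝ᵥ (effLaplacian (L ^ (K + 1)) M (aK a L (K + 1)) (((L ^ (K + 1) : ℕ) : ℝ) ^ 2) m2 *ᵥ φ) / 2)) * Real.exp (t * W φ))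
      (fun K t τ => ∫ φ in (bif τ then {φ : Tor M → ℝ | ∀ x, |φ x| ≤ R K}ᶜ else {φ : Tor M → ℝ | ∀ x, |φ x| ≤ R K}),
        Real.exp (-(φ ⬝ᵥ (effLaplacian (L ^ (K + 1 + 1)) M (aK a L (K + 1 + 1)) (((L ^ (K + 1 + 1) : ℕ) : ℝ) ^ 2) m2 *ᵥ φ) / 2)) * Real.exp (t * W φ))
      (fun _ _ => ({true} : Finset Bool))
      (fun K => Real.exp (2 * (l₀ * B)) * Real.sqrt 2 ^ Fintype.card (Tor M) * Real.exp (-(((aminL a L)⁻¹ + m2⁻¹)⁻¹ * R K ^ 2 / 4)))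
      (fun _ _ _ => 0) (fun _ _ _ => 0) (fun _ => 0)
      (hybridDelta vol (fun K => (Real.exp (2 * (l₀ * B)) - 1) * (thetaK a L (K + 1) 1 * a) * X.card / (2 * ((aminL a L)⁻¹ + m2⁻¹)⁻¹) / vol)
        fun K => Real.exp (2 * (l₀ * B)) * Real.sqrt 2 ^ Fintype.card (Tor M) * Real.exp (-(((aminL a L)⁻¹ + m2⁻¹)⁻¹ * R K ^ 2 / 4))) := by
  have hRW := relWeightBound_kingTwoClass M ha hL hm hWm hWb hR hW1 hWs
  exact hybridNE7_noShell hRW (fun K t _ τ _ => integral_nonneg fun φ => (integrand_pos M _ W t φ).le)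
    (fun K t _ τ _ => integral_nonneg fun φ => (integrand_pos M _ W t φ).le)
    (summable_hybridDelta (summable_delta_kingLocal M ha hL m2 l₀ vol B X) hRW.nonneg hRW.lt_one hRW.summable)
    (core_kingLocalTwoClass M ha hL hm hvol X hWm hWb hWloc hR hW1 hWs)

/-- NON-DEGENERACY DISPLAYED: the bad class of the two-class tower is non-empty at every `(K, t)` and the good set is the single small-field class `false`. [folklore] -/
theorem bad_twoClass_nonempty : (∀ (_K : ℕ) (_t : ℝ), (({true} : Finset Bool)).Nonempty) ∧ (Finset.univ : Finset Bool) \ {true} = {false} :=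
  ⟨fun _ _ => Finset.singleton_nonempty _, by decide⟩

end King

/-! ## §3 The explicit radius: every hypothesis discharged, `δ′` volume-free and radius-free -/
section Explicit

variable {d : ℕ} (M : Fin d → ℕ) [hM : ∀ μ, NeZero (M μ)]
variable {l₀ vol B : ℝ} {W : (Tor M → ℝ) → ℝ}

/-- **THE EXPLICIT RADIUS KILLS THE WEIGHT CONDITIONS** [folklore]: with `R_K = √(4(K + 1 + 2l₀B + |Tor M|·log√2)∕γ₀)` (`γ₀ > 0`, `l₀B ≥ 0`), n14-c's large-field weight
`e^{2l₀B}·√2^{|Tor M|}·e^{−γ₀R_K²∕4}` IS `e^{−(K+1)}`. -/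
theorem kingWeight_explicitRadius_eq {γ₀ : ℝ} (hγ : 0 < γ₀) (hlB : 0 ≤ l₀ * B) (K : ℕ) :
    Real.exp (2 * (l₀ * B)) * Real.sqrt 2 ^ Fintype.card (Tor M) *
        Real.exp (-(γ₀ * Real.sqrt (4 * ((K : ℝ) + 1 + 2 * (l₀ * B) + Fintype.card (Tor M) * Real.log (Real.sqrt 2)) / γ₀) ^ 2 / 4))
      = Real.exp (-((K : ℝ) + 1)) := by
  have hs2 : 0 < Real.sqrt 2 := Real.sqrt_pos.2 (by norm_num)
  have hlog : 0 ≤ Real.log (Real.sqrt 2) := Real.log_nonneg (by rw [← Real.sqrt_one]; exact Real.sqrt_le_sqrt (by norm_num))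
  have hrad : 0 ≤ 4 * ((K : ℝ) + 1 + 2 * (l₀ * B) + Fintype.card (Tor M) * Real.log (Real.sqrt 2)) / γ₀ := by positivity
  rw [Real.sq_sqrt hrad, show Real.sqrt 2 ^ Fintype.card (Tor M) = Real.exp (Fintype.card (Tor M) * Real.log (Real.sqrt 2)) by
    rw [Real.exp_nat_mul, Real.exp_log hs2], ← Real.exp_add, ← Real.exp_add]
  congr 1
  field_simp
  ring

/-- `Σ_K e^{−(K+1)} < ∞`. [folklore] -/
theorem summable_exp_neg_succ : Summable fun K : ℕ => Real.exp (-((K : ℝ) + 1)) := by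
  have h := (Real.summable_exp_nat_mul_iff.2 (show (-1 : ℝ) < 0 by norm_num)).mul_left (Real.exp (-1))
  refine h.congr fun K => ?_
  rw [← Real.exp_add]
  congr 1
  ring

/-- **★★ THE `hedge` ∕ `h19` SHAPE WITH A NON-EMPTY BAD CLASS, EVERY HYPOTHESIS DISCHARGED** [folklore ∘ §2 + `kingWeight_explicitRadius_eq`]: King's data `a, m² > 0`, `L ≥ 2`, a unit
torus `Tor M`; `vol > 0`, `l₀ ≥ 0`; a bounded measurable observable `W` LOCAL on `X` — NOTHING ELSE.  With the explicit small-field radius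
`R_K = √(4(K + 1 + 2l₀B + |Tor M|·log√2)∕γ₀)` the two-class tower (`Bad K t = {true}`, the complement of the box) satisfies `∃ δ, Spine.NE7.Core … δ ∧ Summable δ` with
`δ_K = (e^{2l₀B} − 1)·θ_{K+1}·a·|X|∕(2γ₀·vol) − log(1 − e^{−(K+1)})∕vol`: geometric, VOLUME-FREE and RADIUS-FREE — on the annealed road the radius feeds the weight only, so the DENS
road's radius ∕ remainder trade-off and its residual condition `W₀ < 1` (n14-c `cauchy_genFun_kingGaussian`) are gone. [cite: King1986, Prop 3.10 (3.91)–(3.92) p.669; p.655 (template)] -/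
theorem exists_core_summable_kingLocalTwoClass_explicit {a : ℝ} (ha : 0 < a) {L : ℕ} [NeZero L] (hL : 2 ≤ L) {m2 : ℝ} (hm : 0 < m2) (hvol : 0 < vol)
    (hl₀ : 0 ≤ l₀) (X : Finset (Tor M)) (hWm : Measurable W) (hWb : ∀ φ, |W φ| ≤ B) (hWloc : ∀ φ ψ : Tor M → ℝ, (∀ x ∈ X, φ x = ψ x) → W φ = W ψ) :
    ∃ δ : ℕ → ℝ, Core l₀ vol (fun _ => (Finset.univ : Finset Bool)) (fun _ _ => ({true} : Finset Bool))
      (fun K t τ => ∫ φ in (bif τ then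
          {φ : Tor M → ℝ | ∀ x, |φ x| ≤ Real.sqrt (4 * ((K : ℝ) + 1 + 2 * (l₀ * B) + Fintype.card (Tor M) * Real.log (Real.sqrt 2)) / ((aminL a L)⁻¹ + m2⁻¹)⁻¹)}ᶜ
        else {φ : Tor M → ℝ | ∀ x, |φ x| ≤ Real.sqrt (4 * ((K : ℝ) + 1 + 2 * (l₀ * B) + Fintype.card (Tor M) * Real.log (Real.sqrt 2)) / ((aminL a L)⁻¹ + m2⁻¹)⁻¹)}),
        Real.exp (-(φ ⬝ᵥ (effLaplacian (L ^ (K + 1)) M (aK a L (K + 1)) (((L ^ (K + 1) : ℕ) : ℝ) ^ 2) m2 *ᵥ φ) / 2)) * Real.exp (t * W φ))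
      (fun K t τ => ∫ φ in (bif τ then
          {φ : Tor M → ℝ | ∀ x, |φ x| ≤ Real.sqrt (4 * ((K : ℝ) + 1 + 2 * (l₀ * B) + Fintype.card (Tor M) * Real.log (Real.sqrt 2)) / ((aminL a L)⁻¹ + m2⁻¹)⁻¹)}ᶜ
        else {φ : Tor M → ℝ | ∀ x, |φ x| ≤ Real.sqrt (4 * ((K : ℝ) + 1 + 2 * (l₀ * B) + Fintype.card (Tor M) * Real.log (Real.sqrt 2)) / ((aminL a L)⁻¹ + m2⁻¹)⁻¹)}),
        Real.exp (-(φ ⬝ᵥ (effLaplacian (L ^ (K + 1 + 1)) M (aK a L (K + 1 + 1)) (((L ^ (K + 1 + 1) : ℕ) : ℝ) ^ 2) m2 *ᵥ φ) / 2)) * Real.exp (t * W φ)) δ ∧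
      Summable δ ∧
      ∀ K, δ K = (Real.exp (2 * (l₀ * B)) - 1) * (thetaK a L (K + 1) 1 * a) * X.card / (2 * ((aminL a L)⁻¹ + m2⁻¹)⁻¹) / vol
        + -Real.log (1 - Real.exp (-((K : ℝ) + 1))) / vol := by
  have hγ := gamma0_pos ha hL hm
  have hB : 0 ≤ B := (abs_nonneg _).trans (hWb fun _ => 0)
  have hlB : 0 ≤ l₀ * B := mul_nonneg hl₀ hB
  have hWeq : (fun K : ℕ => Real.exp (2 * (l₀ * B)) * Real.sqrt 2 ^ Fintype.card (Tor M) *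
      Real.exp (-(((aminL a L)⁻¹ + m2⁻¹)⁻¹ * Real.sqrt (4 * ((K : ℝ) + 1 + 2 * (l₀ * B) + Fintype.card (Tor M) * Real.log (Real.sqrt 2)) /
        ((aminL a L)⁻¹ + m2⁻¹)⁻¹) ^ 2 / 4))) = fun K : ℕ => Real.exp (-((K : ℝ) + 1)) :=
    funext fun K => kingWeight_explicitRadius_eq M hγ hlB K
  have hW1 : ∀ K : ℕ, Real.exp (2 * (l₀ * B)) * Real.sqrt 2 ^ Fintype.card (Tor M) *
      Real.exp (-(((aminL a L)⁻¹ + m2⁻¹)⁻¹ * Real.sqrt (4 * ((K : ℝ) + 1 + 2 * (l₀ * B) + Fintype.card (Tor M) * Real.log (Real.sqrt 2)) /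
        ((aminL a L)⁻¹ + m2⁻¹)⁻¹) ^ 2 / 4)) < 1 := fun K => by
    rw [kingWeight_explicitRadius_eq M hγ hlB K]
    exact Real.exp_lt_one_iff.2 (by have : (0 : ℝ) ≤ K := Nat.cast_nonneg K; linarith)
  have hWs : Summable fun K : ℕ => Real.exp (2 * (l₀ * B)) * Real.sqrt 2 ^ Fintype.card (Tor M) *
      Real.exp (-(((aminL a L)⁻¹ + m2⁻¹)⁻¹ * Real.sqrt (4 * ((K : ℝ) + 1 + 2 * (l₀ * B) + Fintype.card (Tor M) * Real.log (Real.sqrt 2)) /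
        ((aminL a L)⁻¹ + m2⁻¹)⁻¹) ^ 2 / 4)) := by
    rw [hWeq]; exact summable_exp_neg_succ
  obtain ⟨δ, hcore, hsum, hδ⟩ := exists_core_summable_kingLocalTwoClass M ha hL hm hvol X hWm hWb hWloc
    (R := fun K => Real.sqrt (4 * ((K : ℝ) + 1 + 2 * (l₀ * B) + Fintype.card (Tor M) * Real.log (Real.sqrt 2)) / ((aminL a L)⁻¹ + m2⁻¹)⁻¹))
    (fun K => Real.sqrt_nonneg _) hW1 hWs
  refine ⟨δ, hcore, hsum, fun K => ?_⟩
  rw [hδ K, kingWeight_explicitRadius_eq M hγ hlB K]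

/-- **★★ `HybridNE7` ON THE TWO-CLASS KING TOWER FOR A LOCAL OBSERVABLE, EVERY HYPOTHESIS DISCHARGED** [folklore ∘ `hybridNE7_kingLocalTwoClass` + `kingWeight_explicitRadius_eq`]:
the joint binder list of the spine's NE7 assembly with `Bad = {true}` at every `(K, t)`, weight `W_K = e^{−(K+1)}` PRODUCED (not posited), no shells, and the volume-free,
radius-free `δ′ = hybridDelta vol δ^loc (K ↦ e^{−(K+1)})`. -/
theorem hybridNE7_kingLocalTwoClass_explicit {a : ℝ} (ha : 0 < a) {L : ℕ} [NeZero L] (hL : 2 ≤ L) {m2 : ℝ} (hm : 0 < m2) (hvol : 0 < vol) (hl₀ : 0 ≤ l₀)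
    (X : Finset (Tor M)) (hWm : Measurable W) (hWb : ∀ φ, |W φ| ≤ B) (hWloc : ∀ φ ψ : Tor M → ℝ, (∀ x ∈ X, φ x = ψ x) → W φ = W ψ) :
    HybridNE7 l₀ vol (fun _ => (Finset.univ : Finset Bool))
      (fun K t τ => ∫ φ in (bif τ then
          {φ : Tor M → ℝ | ∀ x, |φ x| ≤ Real.sqrt (4 * ((K : ℝ) + 1 + 2 * (l₀ * B) + Fintype.card (Tor M) * Real.log (Real.sqrt 2)) / ((aminL a L)⁻¹ + m2⁻¹)⁻¹)}ᶜ
        else {φ : Tor M → ℝ | ∀ x, |φ x| ≤ Real.sqrt (4 * ((K : ℝ) + 1 + 2 * (l₀ * B) + Fintype.card (Tor M) * Real.log (Real.sqrt 2)) / ((aminL a L)⁻¹ + m2⁻¹)⁻¹)}),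
        Real.exp (-(φ ⬝ᵥ (effLaplacian (L ^ (K + 1)) M (aK a L (K + 1)) (((L ^ (K + 1) : ℕ) : ℝ) ^ 2) m2 *ᵥ φ) / 2)) * Real.exp (t * W φ))
      (fun K t τ => ∫ φ in (bif τ then
          {φ : Tor M → ℝ | ∀ x, |φ x| ≤ Real.sqrt (4 * ((K : ℝ) + 1 + 2 * (l₀ * B) + Fintype.card (Tor M) * Real.log (Real.sqrt 2)) / ((aminL a L)⁻¹ + m2⁻¹)⁻¹)}ᶜ
        else {φ : Tor M → ℝ | ∀ x, |φ x| ≤ Real.sqrt (4 * ((K : ℝ) + 1 + 2 * (l₀ * B) + Fintype.card (Tor M) * Real.log (Real.sqrt 2)) / ((aminL a L)⁻¹ + m2⁻¹)⁻¹)}),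
        Real.exp (-(φ ⬝ᵥ (effLaplacian (L ^ (K + 1 + 1)) M (aK a L (K + 1 + 1)) (((L ^ (K + 1 + 1) : ℕ) : ℝ) ^ 2) m2 *ᵥ φ) / 2)) * Real.exp (t * W φ))
      (fun _ _ => ({true} : Finset Bool)) (fun K => Real.exp (-((K : ℝ) + 1)))
      (fun _ _ _ => 0) (fun _ _ _ => 0) (fun _ => 0)
      (hybridDelta vol (fun K => (Real.exp (2 * (l₀ * B)) - 1) * (thetaK a L (K + 1) 1 * a) * X.card / (2 * ((aminL a L)⁻¹ + m2⁻¹)⁻¹) / vol)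
        fun K => Real.exp (-((K : ℝ) + 1))) := by
  have hγ := gamma0_pos ha hL hm
  have hB : 0 ≤ B := (abs_nonneg _).trans (hWb fun _ => 0)
  have hlB : 0 ≤ l₀ * B := mul_nonneg hl₀ hB
  have hWeq : (fun K : ℕ => Real.exp (2 * (l₀ * B)) * Real.sqrt 2 ^ Fintype.card (Tor M) *
      Real.exp (-(((aminL a L)⁻¹ + m2⁻¹)⁻¹ * Real.sqrt (4 * ((K : ℝ) + 1 + 2 * (l₀ * B) + Fintype.card (Tor M) * Real.log (Real.sqrt 2)) /
        ((aminL a L)⁻¹ + m2⁻¹)⁻¹) ^ 2 / 4))) = fun K : ℕ => Real.exp (-((K : ℝ) + 1)) :=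
    funext fun K => kingWeight_explicitRadius_eq M hγ hlB K
  have hW1 : ∀ K : ℕ, Real.exp (2 * (l₀ * B)) * Real.sqrt 2 ^ Fintype.card (Tor M) *
      Real.exp (-(((aminL a L)⁻¹ + m2⁻¹)⁻¹ * Real.sqrt (4 * ((K : ℝ) + 1 + 2 * (l₀ * B) + Fintype.card (Tor M) * Real.log (Real.sqrt 2)) /
        ((aminL a L)⁻¹ + m2⁻¹)⁻¹) ^ 2 / 4)) < 1 := fun K => by
    rw [kingWeight_explicitRadius_eq M hγ hlB K]
    exact Real.exp_lt_one_iff.2 (by have : (0 : ℝ) ≤ K := Nat.cast_nonneg K; linarith)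
  have hWs : Summable fun K : ℕ => Real.exp (2 * (l₀ * B)) * Real.sqrt 2 ^ Fintype.card (Tor M) *
      Real.exp (-(((aminL a L)⁻¹ + m2⁻¹)⁻¹ * Real.sqrt (4 * ((K : ℝ) + 1 + 2 * (l₀ * B) + Fintype.card (Tor M) * Real.log (Real.sqrt 2)) /
        ((aminL a L)⁻¹ + m2⁻¹)⁻¹) ^ 2 / 4)) := by
    rw [hWeq]; exact summable_exp_neg_succ
  have h := hybridNE7_kingLocalTwoClass M ha hL hm hvol X hWm hWb hWloc
    (R := fun K => Real.sqrt (4 * ((K : ℝ) + 1 + 2 * (l₀ * B) + Fintype.card (Tor M) * Real.log (Real.sqrt 2)) / ((aminL a L)⁻¹ + m2⁻¹)⁻¹))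
    (fun K => Real.sqrt_nonneg _) hW1 hWs
  rw [hWeq] at h
  exact h

/-- **A2 EXHIBITED** [folklore ∘ `exists_core_summable_kingLocalTwoClass_explicit`]: the single-site observable `W φ = cos φ(x₀)` is bounded by `1`, measurable and local on `X = {x₀}`, so the
two-class tower with the explicit radius inhabits `∃ δ, Core … {true} … δ ∧ Summable δ` from the MODEL's DATA ALONE, with `δ_K = (e^{2l₀} − 1)·θ_{K+1}·a∕(2γ₀·vol) − log(1 − e^{−(K+1)})∕vol`
— one site's worth, whatever the torus. -/
theorem exists_core_summable_kingLocalTwoClass_cos_site {a : ℝ} (ha : 0 < a) {L : ℕ} [NeZero L] (hL : 2 ≤ L) {m2 : ℝ} (hm : 0 < m2) (hvol : 0 < vol)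
    (hl₀ : 0 ≤ l₀) (x₀ : Tor M) :
    ∃ δ : ℕ → ℝ, Core l₀ vol (fun _ => (Finset.univ : Finset Bool)) (fun _ _ => ({true} : Finset Bool))
      (fun K t τ => ∫ φ in (bif τ then
          {φ : Tor M → ℝ | ∀ x, |φ x| ≤ Real.sqrt (4 * ((K : ℝ) + 1 + 2 * (l₀ * 1) + Fintype.card (Tor M) * Real.log (Real.sqrt 2)) / ((aminL a L)⁻¹ + m2⁻¹)⁻¹)}ᶜ
        else {φ : Tor M → ℝ | ∀ x, |φ x| ≤ Real.sqrt (4 * ((K : ℝ) + 1 + 2 * (l₀ * 1) + Fintype.card (Tor M) * Real.log (Real.sqrt 2)) / ((aminL a L)⁻¹ + m2⁻¹)⁻¹)}),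
        Real.exp (-(φ ⬝ᵥ (effLaplacian (L ^ (K + 1)) M (aK a L (K + 1)) (((L ^ (K + 1) : ℕ) : ℝ) ^ 2) m2 *ᵥ φ) / 2)) * Real.exp (t * Real.cos (φ x₀)))
      (fun K t τ => ∫ φ in (bif τ then
          {φ : Tor M → ℝ | ∀ x, |φ x| ≤ Real.sqrt (4 * ((K : ℝ) + 1 + 2 * (l₀ * 1) + Fintype.card (Tor M) * Real.log (Real.sqrt 2)) / ((aminL a L)⁻¹ + m2⁻¹)⁻¹)}ᶜ
        else {φ : Tor M → ℝ | ∀ x, |φ x| ≤ Real.sqrt (4 * ((K : ℝ) + 1 + 2 * (l₀ * 1) + Fintype.card (Tor M) * Real.log (Real.sqrt 2)) / ((aminL a L)⁻¹ + m2⁻¹)⁻¹)}),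
        Real.exp (-(φ ⬝ᵥ (effLaplacian (L ^ (K + 1 + 1)) M (aK a L (K + 1 + 1)) (((L ^ (K + 1 + 1) : ℕ) : ℝ) ^ 2) m2 *ᵥ φ) / 2)) * Real.exp (t * Real.cos (φ x₀))) δ ∧
      Summable δ ∧
      ∀ K, δ K = (Real.exp (2 * l₀) - 1) * (thetaK a L (K + 1) 1 * a) / (2 * ((aminL a L)⁻¹ + m2⁻¹)⁻¹) / vol + -Real.log (1 - Real.exp (-((K : ℝ) + 1))) / vol := by
  obtain ⟨δ, hcore, hsum, hδ⟩ := exists_core_summable_kingLocalTwoClass_explicit M ha hL hm hvol hl₀ ({x₀} : Finset (Tor M))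
    (W := fun φ : Tor M → ℝ => Real.cos (φ x₀)) (B := 1) (Real.continuous_cos.measurable.comp (measurable_pi_apply x₀)) (fun φ => Real.abs_cos_le_one _)
    (fun φ ψ hX => by simp only [hX x₀ (Finset.mem_singleton_self x₀)])
  refine ⟨δ, hcore, hsum, fun K => ?_⟩
  rw [hδ K, Finset.card_singleton, Nat.cast_one, mul_one, mul_one]

end Explicit

end Summit.QuantumFields.YangMills.BalabanUVNodes.N19KingLocalTwoClass

end
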